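import Summits.Langlands.Langlands.Theorems.AdjointSeedFromDuality.Negative.AdjointSeedFromDualityLoadBearing

/-!
# `AdjointSeedFromDuality` (crux stmt-Langlands-16780, route `RamifiedCoefficientSeed`):
# the EVEN-seed variant of the conclusion is refuted under the parity hypothesis H3
# (negative-side support, refuter cdisprove seat; does NOT refute the crux)

The crux concludes with an ODD `ρ₀ : Γ_ℚ →ₜ* GL₂(ℚ̄_p)` and `η` such that
`‖tr ρ(σ) − η(σ)(tr ρ₀(σ)²/det ρ₀(σ) − 1)‖ < 1` for all `σ`.  Here we record, sorry-free, that the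
parity of the seed is FORCED by H3 (`tr ρ(c) = ±1` at a complex conjugation `c`): no `ρ₀` that is
EVEN at `c` (`det ρ₀(c) = +1`) can satisfy the congruence when `p ≠ 2`, because an involution of
determinant `+1` in `GL₂` has `tr²/det − 1 = 3` (`adTrace_eq_three_of_mul_self_eq_one`) and
`‖±1 ∓ 3‖ ∈ {‖2‖, ‖4‖} = {1}`.  Together with `forces_parity` of the companion file
(`AdjointSeedFromDualityLoadBearing`): "odd" in the conclusion and H3 in the hypotheses determine
each other.  Moral for provers: there is no slack in the parity bookkeeping — the lead's stub E
(`det τ̄(c) = −1`) is the residual form of exactly this computation.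
-/

noncomputable section

-- `Summit.Langlands.Langlands.…` repeats a namespace component by design (D-0017 nested layout).
set_option linter.dupNamespace false

namespace Summit.Langlands.Langlands.Theorems.AdjointSeedFromDuality.Negative

open scoped MatrixGroups
open Summit.Langlands.Langlands.Theses.RamifiedCoefficientSeed
open Literature.NumberTheory.GaloisRepresentations

/-- An involution of determinant `+1` in `M₂(F)` has `tr² = 4` (diagonal entries of `M² = 1` and
`det M = 1`), hence adjoint trace `tr²/det − 1 = 3`. [folklore] -/
theorem adTrace_eq_three_of_mul_self_eq_one {F : Type*} [Field F] {M : Matrix (Fin 2) (Fin 2) F}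
    (hM : M * M = 1) (hdet : M.det = 1) : M.trace ^ 2 * (M.det)⁻¹ - 1 = 3 := by
  have h00 : (M * M) 0 0 = (1 : Matrix (Fin 2) (Fin 2) F) 0 0 := by rw [hM]
  have h11 : (M * M) 1 1 = (1 : Matrix (Fin 2) (Fin 2) F) 1 1 := by rw [hM]
  simp only [Matrix.mul_apply, Fin.sum_univ_two, Matrix.one_apply_eq] at h00 h11
  rw [hdet, inv_one, mul_one, Matrix.trace_fin_two]
  rw [Matrix.det_fin_two] at hdet
  linear_combination h00 + h11 + 2 * hdet

/-- **No EVEN seed under H3.**  For `p ≠ 2` and `ρ : Γ_ℚ →ₜ* GL₃(ℚ̄_p)`: if a complex conjugation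
`c` has `tr ρ(c) = ±1`, there are NO `ρ₀ : Γ_ℚ →ₜ* GL₂(ℚ̄_p)`, `η` with `det ρ₀(c) = 1` and
`‖tr ρ(σ) − η(σ)(tr ρ₀(σ)²/det ρ₀(σ) − 1)‖ < 1` for all `σ` (at `σ = c` it would read
`‖±1 ∓ 3‖ < 1`, while `‖2‖ = ‖4‖ = 1`).  The even-seed variant of the crux's conclusion is thus
incompatible with its hypothesis H3. [folklore] -/
theorem no_even_seed {p : ℕ} [Fact p.Prime] (hp2 : p ≠ 2) {ρ : FramedGaloisRep ℚ (PadicAlgCl p) 3}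
    {φ : ℚ →+* ℝ} {c : Field.absoluteGaloisGroup ℚ} (hc : IsComplexConjugation φ c)
    (htr : (ρ c).val.trace = 1 ∨ (ρ c).val.trace = -1) :
    ¬ ∃ (ρ₀ : FramedGaloisRep ℚ (PadicAlgCl p) 2) (η : FramedGaloisRep ℚ (PadicAlgCl p) 1),
      Matrix.GeneralLinearGroup.det (ρ₀ c) = 1 ∧ ∀ σ, ‖(ρ σ).val.trace -
        (η σ).val 0 0 * ((ρ₀ σ).val.trace ^ 2 * ((ρ₀ σ).val.det)⁻¹ - 1)‖ < 1 := by
  rintro ⟨ρ₀, η, heven, hcong⟩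
  have hc2 : c * c = 1 := by rw [← sq]; exact hc.sq_eq_one
  have hM : (ρ₀ c).val * (ρ₀ c).val = 1 := by
    rw [← Units.val_mul, ← map_mul, hc2, map_one, Units.val_one]
  have hdet : (ρ₀ c).val.det = 1 := by
    rw [← Matrix.GeneralLinearGroup.val_det_apply, heven, Units.val_one]
  have h3 : (ρ₀ c).val.trace ^ 2 * ((ρ₀ c).val.det)⁻¹ - 1 = 3 :=
    adTrace_eq_three_of_mul_self_eq_one hM hdet
  have hη : (η c).val 0 0 * (η c).val 0 0 = 1 := by rw [entry_mul, hc2, entry_one]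
  have hp2' : p.Coprime 2 := (Nat.coprime_primes Fact.out Nat.prime_two).mpr hp2
  have hp4 : p.Coprime 4 := by simpa using Nat.Coprime.mul_right hp2' hp2'
  have n2 : ‖(2 : PadicAlgCl p)‖ = 1 := by exact_mod_cast norm_natCast_eq_one hp2'
  have n4 : ‖(4 : PadicAlgCl p)‖ = 1 := by exact_mod_cast norm_natCast_eq_one hp4
  have hc' := hcong c
  rw [h3] at hc'
  rcases mul_self_eq_one_iff.mp hη with h1 | h1 <;> rcases htr with h2 | h2 <;>
    rw [h1, h2] at hc' <;> norm_num at hc' <;> linarith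

end Summit.Langlands.Langlands.Theorems.AdjointSeedFromDuality.Negative
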